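import Mathlib
import Literature.NumberTheory.Transcendental.DrinfeldAssociatorHexagonLoop
import Literature.NumberTheory.Transcendental.DrinfeldAssociatorEdge
import Literature.NumberTheory.Transcendental.DrinfeldAssociatorProofs
import Literature.NumberTheory.Transcendental.DrinfeldAssociatorIsGroupLikeProofs
import HarnessLib

/-!
# The hexagon equations for the Drinfeld associator by monodromy [Drinfeld1991, (2.12), (5.3)]

Third proofs file towards the hexagon half of `drinfeldAssociator_isAssociatorPair`
(`DrinfeldAssociator.lean`), continuing `DrinfeldAssociatorMonodromy.lean` (holomorphic
fundamental solutions) and `DrinfeldAssociatorHexagonLoop.lean` (the contour and the loop identity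
`σ̂²(cap) σ̂²(seg) σ̂(cap) σ̂(seg) cap seg = 1`). Here we let `ε → 0⁺` and obtain Drinfeld's
theorem that `Φ_KZ` satisfies the hexagon relations [Drinfeld1991, (2.12)] "by using symmetry of
the KZ-system" [Furusho2011, §1], in the 3-cycle form [Drinfeld1991, (5.3)] =
[Furusho2010, Lemma 7, (13)]:

`e^{μA/2} Φ(C,A) e^{μC/2} Φ(B,C) e^{μB/2} Φ(A,B) = 1`, `A + B + C = 0`, `μ = -2πi`
(`drinfeldAssociator_threeCycle`).

5. Exponentials of one letter (`Shuffle.expLetter`): the group law, change of coefficients, and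
   `σ̂(e^{ℓA}) = e^{ℓB}`, `σ̂²(e^{ℓB}) = e^{ℓA}`; the **factorisation of the real segment**
   `seg_ε = e^{-LB} Φ_ε e^{LA}`, `L = log((1-ε)/ε)`, `Φ_ε(W) = ⟨T̂(ε,1-ε), reg_{A,B} W⟩`
   [Furusho2003, Prop. 3.2.3] (`edge_factorisation` of `DrinfeldAssociatorEdge.lean`), and the
   **rearranged loop identity** `σ̂²(K_ε) σ̂²(Φ_ε) σ̂(K_ε) σ̂(Φ_ε) K_ε Φ_ε = 1`,
   `K_ε = e^{LB} cap_ε e^{-LB}` (`loop_identity_K`).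
6. Estimates: families that are `O((1+|log ε|)ⁿ)` / `O((1+|log ε|)ⁿ ε)` coefficientwise and their
   calculus; along the half-circle the pure-`B` coefficients are EXACTLY `(-iπ)ⁿ/n!`
   (`circT_replicate_true`) and words containing `A` are `O(ε)`, the mini-segment is `1 + O(ε)`,
   whence `cap_ε = e^{-iπB} + O(ε)` (`small_cap_sub_E₀`) and `K_ε → E₀ = e^{-iπB}` (`tendsto_Kc`);
   `Φ_ε → Φ_KZ` (`tendsto_Φc`, from `abs_pair_reg_map_sub_drinfeldAssociator_le` and
   `ε(1+|log ε|)ⁿ → 0`); the **limit identity** `σ̂²(E₀) σ̂²(Φ_KZ) σ̂(E₀) σ̂(Φ_KZ) E₀ Φ_KZ = 1` in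
   `ℂ⟨⟨X₀,X₁⟩⟩` (`limit_identity`).
7. Reduction to the truncations `ℂ⟨⟨X₀,X₁⟩⟩/(deg > N)` (`mk_push`, `evalQuotHom`,
   `evalTrunc_exp`): `drinfeldAssociator_threeCycle`.
8. **The 2-cycle relation** `Φ_KZ(B,A) Φ_KZ(A,B) = 1` [Drinfeld1991, §2] by the symmetry
   `τ(z) = 1 - z` (`τ^*ω` exchanges `A` and `B`; the reflected segment is the reversed segment,
   so `swapXY(seg_ε) seg_ε = 1` exactly, hence `swapXY(Φ_ε) Φ_ε = 1` exactly, and `ε → 0⁺`):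
   `drinfeldAssociator_two_cycle`. With [Furusho2010, Lemma 7]
   (`NCSeries.drinfeldHexagons_of_threeCycle`), group-likeness
   (`drinfeldAssociator_isGroupLike_holds`) and complex conjugation (`μ = -2πi ↦ 2πi`):
   **both hexagon equations for `(2πi, Φ_KZ)`, unconditionally** (`drinfeldAssociator_hexagons`),
   and Drinfeld's theorem `drinfeldAssociator_isAssociatorPair` reduced to its pentagon part
   `drinfeldAssociator_pentagon` [Drinfeld1991, (2.13)] alone
   (`drinfeldAssociator_isAssociatorPair_of_pentagon'`).

Everything is proved; no named fact is introduced.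

## References

* V. G. Drinfel'd, *On quasitriangular quasi-Hopf algebras and on a group that is closely
  connected with Gal(Q̄/Q)*, Leningrad Math. J. 2 (1991), 829–860, §2, (2.12), §5, (5.3).
  [Drinfeld1991]
* H. Furusho, *Double shuffle relation for associators*, Ann. of Math. 174 (2011), §1 (p. 3 of
  arXiv:0808.0319: "It is shown in [Dr] that Φ_KZ satisfies GT-relations (with μ = 2πi) by
  using symmetry of the KZ-system on configuration spaces"). [Furusho2011]
* H. Furusho, *Pentagon and hexagon equations*, Ann. of Math. 171 (2010), Lemmas 6, 7.
  [Furusho2010]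
* H. Furusho, Publ. RIMS 39 (2003), §3.2, Prop. 3.2.3 (`Φ_KZ` as a regularised holonomy).
  [Furusho2003]
-/

noncomputable section

open MeasureTheory intervalIntegral Set Filter Metric Complex
open scoped BigOperators Topology Real

namespace Literature.NumberTheory.Transcendental

universe u

/-! ## 5. Exponentials of letters, the factorisation of `seg`, and the rearranged loop identity -/

namespace Shuffle

section ExpLetterAlgebra

universe v w
variable {α : Type v} [DecidableEq α] {K : Type w} [CommRing K] [Algebra ℚ K]

/-- `exp(ℓ c)` vanishes off the powers of `c`. [folklore] -/
theorem expLetter_apply_of_ne (c : α) (ℓ : K) {w : List α} (hw : w ≠ List.replicate w.length c) :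
    expLetter c ℓ w = 0 := by
  unfold expLetter; rw [if_neg hw]

/-- **The group law** `exp(a c) exp(b c) = exp((a+b) c)` for exponentials of one letter.
[folklore] -/
theorem expLetter_mul_expLetter (c : α) (a b : K) :
    expLetter c a * expLetter c b = expLetter c (a + b) := by
  funext w
  by_cases hw : w = List.replicate w.length c
  · set n := w.length with hn
    rw [hw, NCSeries.mul_apply_replicate, expLetter_replicate, add_pow, Finset.mul_sum]
    refine Finset.sum_congr rfl fun k hk => ?_
    rw [Finset.mem_range] at hk
    rw [expLetter_replicate, expLetter_replicate]
    have hq : algebraMap ℚ K (1 / k.factorial) * algebraMap ℚ K (1 / (n - k).factorial) =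
        algebraMap ℚ K (1 / n.factorial) * (n.choose k : K) := by
      rw [← map_natCast (algebraMap ℚ K), ← map_mul, ← map_mul]
      congr 1
      rw [Nat.cast_choose ℚ (by omega : k ≤ n)]
      field_simp
    calc algebraMap ℚ K (1 / k.factorial) * a ^ k * (algebraMap ℚ K (1 / (n - k).factorial) * b ^ (n - k))
        = (algebraMap ℚ K (1 / k.factorial) * algebraMap ℚ K (1 / (n - k).factorial)) *
            (a ^ k * b ^ (n - k)) := by ring
      _ = algebraMap ℚ K (1 / n.factorial) * (a ^ k * b ^ (n - k) * (n.choose k : K)) := by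
          rw [hq]; ring
  · rw [expLetter_apply_of_ne c (a + b) hw, NCSeries.mul_apply]
    have hex : ∃ d ∈ w, d ≠ c := by
      by_contra hall
      push Not at hall
      exact hw (List.eq_replicate_iff.mpr ⟨rfl, hall⟩)
    obtain ⟨d, hd, hdc⟩ := hex
    refine Finset.sum_eq_zero fun p hp => ?_
    rw [NCSeries.mem_splits] at hp
    rw [← hp, List.mem_append] at hd
    rcases hd with h | h
    · rw [expLetter_eq_zero_of_mem c a h hdc, zero_mul]
    · rw [expLetter_eq_zero_of_mem c b h hdc, mul_zero]

/-- `exp(0 · c) = 1`. [folklore] -/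
theorem expLetter_zero (c : α) : expLetter c (0 : K) = 1 := by
  funext w
  cases w with
  | nil => rw [expLetter_nil]; rfl
  | cons d w =>
    rw [NCSeries.one_apply_cons]
    unfold expLetter
    split_ifs with h
    · simp
    · rfl

/-- `exp(ℓ c) exp(-ℓ c) = 1`. [folklore] -/
theorem expLetter_mul_expLetter_neg (c : α) (ℓ : K) : expLetter c ℓ * expLetter c (-ℓ) = 1 := by
  rw [expLetter_mul_expLetter, add_neg_cancel, expLetter_zero]

/-- `exp(-ℓ c) exp(ℓ c) = 1`. [folklore] -/
theorem expLetter_neg_mul_expLetter (c : α) (ℓ : K) : expLetter c (-ℓ) * expLetter c ℓ = 1 := by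
  rw [expLetter_mul_expLetter, neg_add_cancel, expLetter_zero]

/-- Exponentials of the same letter commute. [folklore] -/
theorem expLetter_comm (c : α) (a b : K) : expLetter c a * expLetter c b = expLetter c b * expLetter c a := by
  rw [expLetter_mul_expLetter, expLetter_mul_expLetter, add_comm]

/-- **Change of coefficients**: `map f (exp(ℓ c)) = exp(f(ℓ) c)`. [folklore] -/
theorem map_expLetter {K' : Type*} [CommRing K'] [Algebra ℚ K'] (f : K →+* K') (c : α) (ℓ : K) :
    NCSeries.map f (expLetter c ℓ) = expLetter c (f ℓ) := by
  funext w
  rw [NCSeries.map_apply]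
  unfold expLetter
  split_ifs with h
  · rw [map_mul, map_pow, RingHom.map_rat_algebraMap]
  · rw [map_zero]

/-- `exp(ℓ c)` is the exponential of the series `ℓ · X_c`. [folklore] -/
theorem expLetter_eq_exp_smul (c : α) (ℓ : K) : expLetter c ℓ = NCSeries.exp (ℓ • NCSeries.letter c) := by
  rw [expLetter_eq_exp]
  congr 1
  funext w
  rw [NCSeries.monomial_apply, NCSeries.smul_apply, NCSeries.letter_apply, smul_eq_mul, mul_ite, mul_one,
    mul_zero]

end ExpLetterAlgebra

end Shuffle

namespace KZHex

open Shuffle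

/-! ### `σ̂` on letters and exponentials of letters -/

/-- `σ̂(X₀) = X₁`. [cite: Drinfeld1991, §2] -/
theorem push_mrho_letter_false :
    NCSeries.push mrho (NCSeries.letter false : NCSeries Bool ℂ) = NCSeries.letter true := by
  rw [NCSeries.push_letter, Fintype.sum_bool]; simp [mrho]

/-- `σ̂(X₁) = -X₀ - X₁`. [cite: Drinfeld1991, §2] -/
theorem push_mrho_letter_true :
    NCSeries.push mrho (NCSeries.letter true : NCSeries Bool ℂ) = -NCSeries.letter false - NCSeries.letter true := by
  rw [NCSeries.push_letter, Fintype.sum_bool]; simp [mrho]; abel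

/-- **`σ̂(e^{ℓA}) = e^{ℓB}`.** [cite: Drinfeld1991, §2] -/
theorem push_mrho_expLetter_false (ℓ : ℂ) :
    NCSeries.push mrho (expLetter false ℓ) = expLetter true ℓ := by
  rw [expLetter_eq_exp_smul, expLetter_eq_exp_smul, NCSeries.push_exp mrho (by simp),
    NCSeries.push_smul_ser, push_mrho_letter_false]

/-- **`σ̂²(e^{ℓB}) = e^{ℓA}`** (`σ̂³ = id`). [cite: Drinfeld1991, §2] -/
theorem push_push_mrho_expLetter_true (ℓ : ℂ) :
    NCSeries.push mrho (NCSeries.push mrho (expLetter true ℓ)) = expLetter false ℓ := by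
  have h1 : (ℓ • (NCSeries.letter true : NCSeries Bool ℂ)) [] = 0 := by simp
  have h2 : (ℓ • (-NCSeries.letter false - NCSeries.letter true : NCSeries Bool ℂ)) [] = 0 := by simp
  rw [expLetter_eq_exp_smul, expLetter_eq_exp_smul, NCSeries.push_exp mrho h1, NCSeries.push_smul_ser,
    push_mrho_letter_true, NCSeries.push_exp mrho h2, NCSeries.push_smul_ser, NCSeries.push_sub_ser,
    NCSeries.push_neg_ser, push_mrho_letter_false, push_mrho_letter_true]
  congr 2
  abel

/-! ### The factorisation of `seg` -/

/-- `L_ε = log((1-ε)/ε)`, the logarithmic divergence of the transport along `[ε, 1-ε]`.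
[cite: Furusho2003, §3.2] -/
def Lr (ε : ℝ) : ℝ := Real.log ((1 - ε) / ε)

/-- **The regularised transport** `Φ_ε(W) = ⟨T̂(ε, 1-ε), reg_{A,B} W⟩` (real coefficients).
[cite: Furusho2003, Prop. 3.2.3] -/
def Φr (ε : ℝ) : NCSeries Bool ℝ := fun W =>
  Shuffle.pair (transportSeries KZ3.F₀ ε (1 - ε)) (Shuffle.reg false true W)

/-- The regularised transport with complex coefficients. [folklore] -/
def Φc (ε : ℝ) : NCSeries Bool ℂ := NCSeries.map (algebraMap ℝ ℂ) (Φr ε)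

section Factorisation

variable {ε : ℝ} (hε : 0 < ε) (hε1 : ε < 1)
include hε hε1

/-- `T̂(ε,1-ε)_A = L_ε`. [folklore] -/
theorem transport_false : transportSeries KZ3.F₀ ε (1 - ε) [false] = Lr ε :=
  KZ3.kzTransport_A hε (by linarith)

/-- `T̂(ε,1-ε)_B = -L_ε`. [folklore] -/
theorem transport_true : transportSeries KZ3.F₀ ε (1 - ε) [true] = -Lr ε := by
  rw [show transportSeries KZ3.F₀ ε (1 - ε) [true] = KZ3.kzTransport ε (1 - ε) [true] from rfl,
    KZ3.kzTransport_B hε1 (by linarith), Lr, show (1 : ℝ) - (1 - ε) = ε by ring, ← Real.log_inv,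
    inv_div]

/-- **Factorisation of the real transport** [Furusho2003, Prop. 3.2.3]:
`T̂(ε, 1-ε) = e^{-L B} Φ_ε e^{L A}`. [cite: Furusho2003, Prop. 3.2.3] -/
theorem transport_factorisation :
    transportSeries KZ3.F₀ ε (1 - ε) = expLetter true (-Lr ε) * Φr ε * expLetter false (Lr ε) := by
  have hε' : ε ∈ Ioo (0 : ℝ) 1 := ⟨hε, hε1⟩
  have hb' : 1 - ε ∈ Ioo (0 : ℝ) 1 := ⟨by linarith, by linarith⟩
  have h := edge_factorisation (x := false) (y := true) (f := KZ3.F₀) Bool.false_ne_true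
    KZ3.continuousOn_F₀ hε' hb'
  rw [transport_true hε hε1, transport_false hε hε1, neg_neg] at h
  have h' : Φr ε = expLetter true (Lr ε) * transportSeries KZ3.F₀ ε (1 - ε) * expLetter false (-Lr ε) := by
    rw [h]; rfl
  rw [h', ← mul_assoc, ← mul_assoc, expLetter_neg_mul_expLetter, one_mul, mul_assoc,
    expLetter_neg_mul_expLetter, mul_one]

/-- **Factorisation of `seg`** (complex coefficients): `seg_ε = e^{-L B} Φ_ε e^{L A}`.
[cite: Furusho2003, Prop. 3.2.3] -/
theorem seg_factorisation :
    seg ε = expLetter true (-(Lr ε : ℂ)) * Φc ε * expLetter false (Lr ε : ℂ) := by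
  rw [seg_eq_map_kzTransport, KZ3.kzTransport, transport_factorisation hε hε1, map_mul, map_mul,
    map_expLetter, map_expLetter, Φc]
  simp

end Factorisation

/-! ### The conjugated cap `K_ε = e^{LB} cap e^{-LB}` and the rearranged loop identity -/

/-- **`K_ε = e^{L B} · cap_ε · e^{-L B}`.** [cite: Drinfeld1991, §2] -/
def Kc (ε : ℝ) : NCSeries Bool ℂ := expLetter true (Lr ε : ℂ) * cap ε * expLetter true (-(Lr ε : ℂ))

/-- **The rearranged loop identity**: `σ̂²(K_ε) σ̂²(Φ_ε) σ̂(K_ε) σ̂(Φ_ε) K_ε Φ_ε = 1` for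
`0 < ε < 1/2` (from `loop_identity_cap`, `seg = e^{-LB} Φ_ε e^{LA}`, `σ̂(e^{LA}) = e^{LB}`,
`σ̂²(e^{LB}) = e^{LA}` and a conjugation by `e^{LA}`). [cite: Drinfeld1991, §2, (2.12)] -/
theorem loop_identity_K {ε : ℝ} (hε : 0 < ε) (hε2 : ε < 1 / 2) :
    NCSeries.push mrho (NCSeries.push mrho (Kc ε)) * NCSeries.push mrho (NCSeries.push mrho (Φc ε)) *
      NCSeries.push mrho (Kc ε) * NCSeries.push mrho (Φc ε) * Kc ε * Φc ε = 1 := by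
  have hε1 : ε < 1 := by linarith
  set σ := NCSeries.push (K := ℂ) mrho with hσ
  set L : ℂ := (Lr ε : ℂ) with hL
  set Ep := expLetter true L with hEp
  set Em := expLetter true (-L) with hEm
  set Ap := expLetter false L with hAp
  set Am := expLetter false (-L) with hAm
  have hσmul : ∀ X Y : NCSeries Bool ℂ, σ (X * Y) = σ X * σ Y := NCSeries.push_mul mrho
  have hσAp : σ Ap = Ep := push_mrho_expLetter_false L
  have hσσEp : σ (σ Ep) = Ap := push_push_mrho_expLetter_true L
  have hAA : Ap * Am = 1 := expLetter_mul_expLetter_neg false L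
  have h := loop_identity_cap hε hε2
  rw [seg_factorisation hε hε1, ← hL, ← hEm, ← hAp] at h
  -- expand `σ̂(seg)` and `σ̂²(seg)` in `h`
  simp only [← hσ, hσmul, hσAp] at h
  -- the common middle block
  set X := σ (σ (cap ε)) * σ (σ Em) * σ (σ (Φc ε)) * σ Ep * σ (cap ε) * σ Em * σ (Φc ε) * Ep *
    cap ε * Em * Φc ε with hX
  have hXA : X * Ap = 1 := by
    rw [hX]; simpa only [mul_assoc] using h
  -- the goal is `Ap * X = 1`
  have goal_eq : σ (σ (Kc ε)) * σ (σ (Φc ε)) * σ (Kc ε) * σ (Φc ε) * Kc ε * Φc ε = Ap * X := by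
    rw [Kc, ← hL, ← hEp, ← hEm]
    simp only [hσmul, hσσEp, hX, mul_assoc]
  rw [goal_eq]
  calc Ap * X = Ap * X * (Ap * Am) := by rw [hAA, mul_one]
    _ = Ap * (X * Ap) * Am := by simp only [mul_assoc]
    _ = 1 := by rw [hXA, mul_one, hAA]

/-! ## 6. Estimates: `O(ε · polylog)` families, the cap, and the limit `ε → 0⁺` -/

/-! ### `ε (1 + |log ε|)ⁿ → 0` -/

/-- `(-log ε)ⁿ ε → 0` as `ε → 0⁺`. [folklore] -/
theorem tendsto_neg_log_pow_mul (n : ℕ) :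
    Tendsto (fun ε : ℝ => (-Real.log ε) ^ n * ε) (𝓝[>] 0) (𝓝 0) := by
  have h := (Real.tendsto_pow_log_div_mul_add_atTop 1 0 n one_ne_zero).comp tendsto_inv_nhdsGT_zero
  refine h.congr' (Eventually.of_forall fun ε => ?_)
  simp only [Function.comp_apply, Real.log_inv, one_mul, add_zero, div_inv_eq_mul]

/-- **`(1 + |log ε|)ⁿ ε → 0` as `ε → 0⁺`.** [folklore] -/
theorem tendsto_one_add_abs_log_pow_mul (n : ℕ) :
    Tendsto (fun ε : ℝ => (1 + |Real.log ε|) ^ n * ε) (𝓝[>] 0) (𝓝 0) := by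
  have hsum : Tendsto (fun ε : ℝ => ∑ k ∈ Finset.range (n + 1), ((n.choose k : ℝ) * ((-Real.log ε) ^ k * ε)))
      (𝓝[>] 0) (𝓝 0) := by
    have h := tendsto_finsetSum (Finset.range (n + 1))
      fun k (_ : k ∈ Finset.range (n + 1)) => (tendsto_neg_log_pow_mul k).const_mul (n.choose k : ℝ)
    simpa using h
  refine hsum.congr' ?_
  filter_upwards [Ioo_mem_nhdsGT (zero_lt_one' ℝ)] with ε hε
  have hlog : |Real.log ε| = -Real.log ε := abs_of_neg (Real.log_neg hε.1 hε.2)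
  rw [hlog, add_comm (1 : ℝ) (-Real.log ε), add_pow, Finset.sum_mul]
  refine Finset.sum_congr rfl fun k _ => ?_
  rw [one_pow, mul_one]; ring

/-! ### Families that are `O((1+|log ε|)ⁿ)` and `O((1+|log ε|)ⁿ ε)` coefficientwise -/

/-- A family of series indexed by `ε ∈ (0, 1/2)` is **log-bounded** if each coefficient is
`O((1 + |log ε|)ⁿ)` for some `n`. [folklore] -/
def LogBdd (X : ℝ → NCSeries Bool ℂ) : Prop :=
  ∀ w : List Bool, ∃ C : ℝ, ∃ n : ℕ, 0 ≤ C ∧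
    ∀ ε ∈ Ioo (0 : ℝ) (1 / 2), ‖X ε w‖ ≤ C * (1 + |Real.log ε|) ^ n

/-- A family of series indexed by `ε ∈ (0, 1/2)` is **small** if each coefficient is
`O((1 + |log ε|)ⁿ ε)` for some `n`. [folklore] -/
def Small (X : ℝ → NCSeries Bool ℂ) : Prop :=
  ∀ w : List Bool, ∃ C : ℝ, ∃ n : ℕ, 0 ≤ C ∧
    ∀ ε ∈ Ioo (0 : ℝ) (1 / 2), ‖X ε w‖ ≤ C * (1 + |Real.log ε|) ^ n * ε

/-- **Small families tend to `0` coefficientwise** as `ε → 0⁺`. [folklore] -/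
theorem Small.tendsto {X : ℝ → NCSeries Bool ℂ} (h : Small X) (w : List Bool) :
    Tendsto (fun ε => X ε w) (𝓝[>] 0) (𝓝 0) := by
  obtain ⟨C, n, hC, hb⟩ := h w
  refine squeeze_zero_norm' ?_ (by simpa using (tendsto_one_add_abs_log_pow_mul n).const_mul C)
  filter_upwards [Ioo_mem_nhdsGT (by norm_num : (0 : ℝ) < 1 / 2)] with ε hε
  rw [← mul_assoc]; exact hb ε hε

/-- Sums of small families are small. [folklore] -/
theorem Small.add {X Y : ℝ → NCSeries Bool ℂ} (hX : Small X) (hY : Small Y) :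
    Small (fun ε => X ε + Y ε) := by
  intro w
  obtain ⟨C, n, hC, hb⟩ := hX w
  obtain ⟨D, m, hD, hb'⟩ := hY w
  refine ⟨C + D, max n m, by positivity, fun ε hε => ?_⟩
  have h1 : (1 : ℝ) ≤ 1 + |Real.log ε| := by linarith [abs_nonneg (Real.log ε)]
  show ‖(X ε + Y ε) w‖ ≤ _
  rw [NCSeries.add_apply]
  calc ‖X ε w + Y ε w‖ ≤ ‖X ε w‖ + ‖Y ε w‖ := norm_add_le _ _
    _ ≤ C * (1 + |Real.log ε|) ^ n * ε + D * (1 + |Real.log ε|) ^ m * ε := add_le_add (hb ε hε) (hb' ε hε)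
    _ ≤ C * (1 + |Real.log ε|) ^ max n m * ε + D * (1 + |Real.log ε|) ^ max n m * ε := by
        exact add_le_add
          (mul_le_mul_of_nonneg_right (mul_le_mul_of_nonneg_left
            (pow_le_pow_right₀ h1 (le_max_left n m)) hC) hε.1.le)
          (mul_le_mul_of_nonneg_right (mul_le_mul_of_nonneg_left
            (pow_le_pow_right₀ h1 (le_max_right n m)) hD) hε.1.le)
    _ = (C + D) * (1 + |Real.log ε|) ^ max n m * ε := by ring

/-- Negatives of small families are small. [folklore] -/
theorem Small.neg {X : ℝ → NCSeries Bool ℂ} (hX : Small X) : Small (fun ε => -X ε) := by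
  intro w
  obtain ⟨C, n, hC, hb⟩ := hX w
  exact ⟨C, n, hC, fun ε hε => by
    show ‖(-X ε) w‖ ≤ _
    rw [NCSeries.neg_apply, norm_neg]; exact hb ε hε⟩

/-- Differences of small families are small. [folklore] -/
theorem Small.sub {X Y : ℝ → NCSeries Bool ℂ} (hX : Small X) (hY : Small Y) :
    Small (fun ε => X ε - Y ε) := by
  simpa [sub_eq_add_neg] using hX.add hY.neg

/-- Constant families are log-bounded. [folklore] -/
theorem logBdd_const (Z : NCSeries Bool ℂ) : LogBdd (fun _ => Z) := fun w =>
  ⟨‖Z w‖, 0, norm_nonneg _, fun ε _ => by simp⟩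

/-- The generic product estimate behind `LogBdd.mul_small` and `Small.mul_logBdd`. [folklore] -/
theorem small_mul_aux {X Y : ℝ → NCSeries Bool ℂ} {CX CY : List Bool → ℝ} {nX nY : List Bool → ℕ}
    (hX0 : ∀ u, 0 ≤ CX u) (hY0 : ∀ u, 0 ≤ CY u)
    (h : ∀ u v, ∀ ε ∈ Ioo (0 : ℝ) (1 / 2),
      ‖X ε u‖ * ‖Y ε v‖ ≤ CX u * CY v * (1 + |Real.log ε|) ^ (nX u + nY v) * ε) :
    Small (fun ε => X ε * Y ε) := by
  intro w
  refine ⟨∑ p ∈ NCSeries.splits w, CX p.1 * CY p.2, (NCSeries.splits w).sup fun p => nX p.1 + nY p.2,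
    Finset.sum_nonneg fun p _ => mul_nonneg (hX0 _) (hY0 _), fun ε hε => ?_⟩
  have h1 : (1 : ℝ) ≤ 1 + |Real.log ε| := by linarith [abs_nonneg (Real.log ε)]
  show ‖(X ε * Y ε) w‖ ≤ _
  rw [NCSeries.mul_apply, Finset.sum_mul, Finset.sum_mul]
  refine (norm_sum_le _ _).trans (Finset.sum_le_sum fun p hp => ?_)
  rw [norm_mul]
  refine (h p.1 p.2 ε hε).trans ?_
  have hp' : nX p.1 + nY p.2 ≤ (NCSeries.splits w).sup fun p => nX p.1 + nY p.2 :=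
    Finset.le_sup (f := fun p => nX p.1 + nY p.2) hp
  exact mul_le_mul_of_nonneg_right (mul_le_mul_of_nonneg_left (pow_le_pow_right₀ h1 hp')
    (mul_nonneg (hX0 _) (hY0 _))) hε.1.le

/-- **Log-bounded times small is small.** [folklore] -/
theorem LogBdd.mul_small {X Y : ℝ → NCSeries Bool ℂ} (hX : LogBdd X) (hY : Small Y) :
    Small (fun ε => X ε * Y ε) := by
  choose CX nX hX0 hXb using hX
  choose CY nY hY0 hYb using hY
  refine small_mul_aux (nX := nX) (nY := nY) hX0 hY0 fun u v ε hε => ?_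
  calc ‖X ε u‖ * ‖Y ε v‖ ≤ (CX u * (1 + |Real.log ε|) ^ nX u) * (CY v * (1 + |Real.log ε|) ^ nY v * ε) :=
        mul_le_mul (hXb u ε hε) (hYb v ε hε) (norm_nonneg _) (mul_nonneg (hX0 u) (by positivity))
    _ = CX u * CY v * (1 + |Real.log ε|) ^ (nX u + nY v) * ε := by rw [pow_add]; ring

/-- **Small times log-bounded is small.** [folklore] -/
theorem Small.mul_logBdd {X Y : ℝ → NCSeries Bool ℂ} (hX : Small X) (hY : LogBdd Y) :
    Small (fun ε => X ε * Y ε) := by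
  choose CX nX hX0 hXb using hX
  choose CY nY hY0 hYb using hY
  refine small_mul_aux (nX := nX) (nY := nY) hX0 hY0 fun u v ε hε => ?_
  calc ‖X ε u‖ * ‖Y ε v‖ ≤ (CX u * (1 + |Real.log ε|) ^ nX u * ε) * (CY v * (1 + |Real.log ε|) ^ nY v) :=
        mul_le_mul (hXb u ε hε) (hYb v ε hε) (norm_nonneg _)
          (mul_nonneg (mul_nonneg (hX0 u) (by positivity)) hε.1.le)
    _ = CX u * CY v * (1 + |Real.log ε|) ^ (nX u + nY v) * ε := by rw [pow_add]; ring

/-! ### Exponentials of letters with logarithmic exponents are log-bounded -/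

/-- `‖exp(ℓ c)_w‖ ≤ ‖ℓ‖^{|w|}`. [folklore] -/
theorem norm_expLetter_le (c : Bool) (ℓ : ℂ) (w : List Bool) : ‖expLetter c ℓ w‖ ≤ ‖ℓ‖ ^ w.length := by
  unfold expLetter
  split_ifs with h
  · rw [norm_mul, norm_pow]
    refine mul_le_of_le_one_left (by positivity) ?_
    rw [show algebraMap ℚ ℂ (1 / (w.length.factorial : ℚ)) = ((w.length.factorial : ℝ) : ℂ)⁻¹ by simp,
      norm_inv, Complex.norm_real, Real.norm_eq_abs, Nat.abs_cast]
    exact inv_le_one_of_one_le₀ (by exact_mod_cast Nat.one_le_iff_ne_zero.mpr (Nat.factorial_ne_zero _))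
  · simp

/-- `|L_ε| ≤ 1 + |log ε|` for `0 < ε < 1/2`. [folklore] -/
theorem abs_Lr_le {ε : ℝ} (hε : 0 < ε) (hε2 : ε < 1 / 2) : |Lr ε| ≤ 1 + |Real.log ε| := by
  have h1ε : 0 < 1 - ε := by linarith
  rw [Lr, Real.log_div h1ε.ne' hε.ne']
  have hl : |Real.log (1 - ε)| ≤ 1 := by
    rw [abs_of_nonpos (Real.log_nonpos h1ε.le (by linarith)), ← Real.log_inv]
    calc Real.log (1 - ε)⁻¹ ≤ (1 - ε)⁻¹ - 1 := Real.log_le_sub_one_of_pos (by positivity)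
      _ ≤ 1 := by
          rw [sub_le_iff_le_add, inv_le_comm₀ h1ε (by norm_num)]; norm_num; linarith
  calc |Real.log (1 - ε) - Real.log ε| ≤ |Real.log (1 - ε)| + |Real.log ε| := abs_sub _ _
    _ ≤ 1 + |Real.log ε| := by linarith

/-- **`e^{± L_ε c}` is log-bounded.** [folklore] -/
theorem logBdd_expLetter (c : Bool) (s : ℝ) (hs : |s| ≤ 1) :
    LogBdd (fun ε => expLetter c ((s * Lr ε : ℝ) : ℂ)) := by
  intro w
  refine ⟨1, w.length, zero_le_one, fun ε hε => ?_⟩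
  refine (norm_expLetter_le c _ w).trans ?_
  rw [one_mul, Complex.norm_real, Real.norm_eq_abs, abs_mul]
  refine pow_le_pow_left₀ (by positivity) ?_ _
  calc |s| * |Lr ε| ≤ 1 * (1 + |Real.log ε|) :=
        mul_le_mul hs (abs_Lr_le hε.1 hε.2) (abs_nonneg _) zero_le_one
    _ = 1 + |Real.log ε| := one_mul _

/-! ### Iterated integrals of a constant density -/

/-- **Iterated integrals of a constant density**: if `g_c ≡ κ` then
`I_{cⁿ}(a,b) = (κ (b-a))ⁿ / n!`. [folklore] -/
theorem citerInt_replicate_const {α : Type u} {g : α → ℝ → ℂ} {c : α} {κ : ℂ} (h : ∀ t, g c t = κ)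
    (a : ℝ) : ∀ (n : ℕ) (b : ℝ),
    citerInt g (List.replicate n c) a b = (κ * ((b - a : ℝ) : ℂ)) ^ n / (n.factorial : ℂ)
  | 0, b => by simp
  | n + 1, b => by
    rw [List.replicate_succ, citerInt_cons]
    have hI : ∀ t, g c t * citerInt g (List.replicate n c) a t =
        κ ^ (n + 1) / (n.factorial : ℂ) * (((t - a : ℝ) : ℂ) ^ n) := by
      intro t
      rw [h t, citerInt_replicate_const h a n t, mul_pow]
      ring
    simp_rw [hI]
    have hcast : (fun t : ℝ => ((t - a : ℝ) : ℂ) ^ n) = fun t => (((t - a) ^ n : ℝ) : ℂ) := by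
      funext t; rw [Complex.ofReal_pow]
    rw [intervalIntegral.integral_const_mul, hcast, intervalIntegral.integral_ofReal,
      intervalIntegral.integral_comp_sub_right (fun x : ℝ => x ^ n) a, integral_pow, sub_self,
      zero_pow (Nat.succ_ne_zero n), sub_zero, mul_pow]
    set X : ℂ := ((b - a : ℝ) : ℂ) with hX
    have hXp : (((b - a) ^ (n + 1) / ((n : ℝ) + 1) : ℝ) : ℂ) = X ^ (n + 1) / ((n : ℂ) + 1) := by
      rw [Complex.ofReal_div, Complex.ofReal_pow, hX]
      congr 1
      push_cast
      ring
    rw [hXp, Nat.factorial_succ]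
    push_cast
    have hn : ((n.factorial : ℂ)) ≠ 0 := by exact_mod_cast Nat.factorial_ne_zero n
    have hn1 : ((n : ℂ) + 1) ≠ 0 := by exact_mod_cast Nat.succ_ne_zero n
    field_simp

/-- The number of deconcatenations of a word is `|w| + 1`. [folklore] -/
theorem card_splits {α : Type u} (w : List α) : (NCSeries.splits w).card = w.length + 1 := by
  rw [NCSeries.splits, Finset.card_map]; simp

section CapEstimate

variable {ε : ℝ} (hε : 0 < ε) (hε2 : ε < 1 / 2)
include hε hε2

/-- **The pure-`B` coefficients of the half-circle transport are exact**:
`circT_ε(Bⁿ) = (-iπ)ⁿ/n!` (the `B`-density is the constant `-i` on `[0, π]`).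
[cite: Drinfeld1991, §2] -/
theorem circT_replicate_true (n : ℕ) :
    circT ε (List.replicate n true) = expLetter true (-(Real.pi : ℂ) * I) (List.replicate n true) := by
  have hε1 : ε < 1 := by linarith
  have h : ∀ t, circDens ε true t = -I := fun t => circPath_dens_true hε hε1 t
  rw [circT, ctransport_apply, citerInt_replicate_const h 0 n Real.pi, expLetter_replicate]
  rw [show algebraMap ℚ ℂ (1 / (n.factorial : ℚ)) = ((n.factorial : ℂ))⁻¹ by simp]
  push_cast
  ring

/-- `∫_0^π ‖circDens true‖ = π`. [folklore] -/
theorem integral_norm_circDens_true : ∫ t in (0 : ℝ)..Real.pi, ‖circDens ε true t‖ = Real.pi := by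
  have hε1 : ε < 1 := by linarith
  have h : ∀ t, ‖circDens ε true t‖ = 1 := fun t => by
    rw [show circDens ε true t = -I from circPath_dens_true hε hε1 t, norm_neg, Complex.norm_I]
  simp_rw [h]
  rw [intervalIntegral.integral_const]; simp

/-- `∫_0^π ‖circDens false‖ ≤ π ε/(1-ε)`. [folklore] -/
theorem integral_norm_circDens_false_le :
    ∫ t in (0 : ℝ)..Real.pi, ‖circDens ε false t‖ ≤ Real.pi * (ε / (1 - ε)) := by
  have hε1 : ε < 1 := by linarith
  have hb : ∀ t ∈ Set.uIoc (0 : ℝ) Real.pi, ‖(‖circDens ε false t‖ : ℝ)‖ ≤ ε / (1 - ε) := fun t _ => by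
    rw [Real.norm_eq_abs, abs_norm]; exact norm_circPath_dens_false_le hε hε1 t
  have h := intervalIntegral.norm_integral_le_of_norm_le_const hb
  rw [sub_zero, abs_of_pos Real.pi_pos, Real.norm_eq_abs] at h
  linarith [le_abs_self (∫ t in (0 : ℝ)..Real.pi, ‖circDens ε false t‖)]

/-- The letterwise `L¹` bound along the half-circle: each letter contributes at most `π`, the
letter `A` at most `πε/(1-ε)`. [folklore] -/
theorem integral_norm_circDens_le (c : Bool) :
    ∫ t in (0 : ℝ)..Real.pi, ‖circDens ε c t‖ ≤ Real.pi := by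
  cases c
  · refine (integral_norm_circDens_false_le hε hε2).trans ?_
    have : ε / (1 - ε) ≤ 1 := by rw [div_le_one (by linarith)]; linarith
    nlinarith [Real.pi_pos]
  · exact (integral_norm_circDens_true hε hε2).le

/-- **`‖circT_ε(v)‖ ≤ π^{|v|}`.** [folklore] -/
theorem norm_circT_le (v : List Bool) : ‖circT ε v‖ ≤ Real.pi ^ v.length := by
  have hε1 : ε < 1 := by linarith
  have hg : ∀ c, ContinuousOn (circDens ε c) univ := fun c => (circPath hε hε1).continuousOn_dens c
  refine (norm_citerInt_le_prod isOpen_univ ordConnected_univ hg (mem_univ 0) v (mem_univ _)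
    Real.pi_pos.le).trans ?_
  calc (v.map fun c => ∫ t in (0 : ℝ)..Real.pi, ‖circDens ε c t‖).prod
      ≤ (v.map fun _ => Real.pi).prod :=
        list_prod_map_le_prod_map v (fun c _ => intervalIntegral.integral_nonneg Real.pi_pos.le
          fun t _ => norm_nonneg _) fun c _ => integral_norm_circDens_le hε hε2 c
    _ = Real.pi ^ v.length := by rw [List.map_const', List.prod_replicate]

/-- **Words containing `A` are small along the half-circle**: `‖circT_ε(v)‖ ≤ 2ε π^{|v|}` if
`A ∈ v`. [folklore] -/
theorem norm_circT_le_of_mem {v : List Bool} (hv : false ∈ v) : ‖circT ε v‖ ≤ 2 * ε * Real.pi ^ v.length := by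
  have hε1 : ε < 1 := by linarith
  have h1ε : 0 < 1 - ε := by linarith
  have hg : ∀ c, ContinuousOn (circDens ε c) univ := fun c => (circPath hε hε1).continuousOn_dens c
  refine (norm_citerInt_le_prod isOpen_univ ordConnected_univ hg (mem_univ 0) v (mem_univ _)
    Real.pi_pos.le).trans ?_
  have hlen : 1 ≤ v.length := List.length_pos_iff.mpr (List.ne_nil_of_mem hv)
  calc (v.map fun c => ∫ t in (0 : ℝ)..Real.pi, ‖circDens ε c t‖).prod
      ≤ Real.pi * (ε / (1 - ε)) * Real.pi ^ (v.length - 1) :=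
        list_prod_le_of_one_small Real.pi_pos.le (by positivity)
          (fun c _ => intervalIntegral.integral_nonneg Real.pi_pos.le fun t _ => norm_nonneg _)
          (fun c _ => integral_norm_circDens_le hε hε2 c) hv (integral_norm_circDens_false_le hε hε2)
    _ = ε / (1 - ε) * Real.pi ^ v.length := by
        rw [mul_comm Real.pi, mul_assoc, ← pow_succ', Nat.sub_add_cancel hlen]
    _ ≤ 2 * ε * Real.pi ^ v.length := by
        refine mul_le_mul_of_nonneg_right ?_ (by positivity)
        rw [div_le_iff₀ h1ε]; nlinarith

/-- **The mini-segment transport is `1 + O(ε)`**: `‖mini_ε(u)‖ ≤ 2ε` for `u ≠ ∅`. [folklore] -/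
theorem norm_mini_le {u : List Bool} (hu : u ≠ []) : ‖mini ε u‖ ≤ 2 * ε := by
  have hε1 : ε < 1 := by linarith
  have h1ε : 0 < 1 - ε := by linarith
  have hI0 : (0 : ℝ) ∉ Ioi (1 : ℝ) := by simp
  have hI1 : (1 : ℝ) ∉ Ioi (1 : ℝ) := by simp
  have hg : ∀ c, ContinuousOn (lineDens c) (Ioi 1) := fun c => (linePath (Ioi 1) hI0 hI1).continuousOn_dens c
  have ha : 1 + ε ∈ Ioi (1 : ℝ) := by simp [hε]
  have hεp : ε < ε / (1 - ε) := by rw [lt_div_iff₀ h1ε]; nlinarith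
  have hb : 1 + ε / (1 - ε) ∈ Ioi (1 : ℝ) := by simp only [mem_Ioi]; linarith
  have hab : 1 + ε ≤ 1 + ε / (1 - ε) := by linarith
  refine (norm_citerInt_le_prod isOpen_Ioi ordConnected_Ioi hg ha u hb hab).trans ?_
  -- each letter's `L¹` norm on the mini-segment is `≤ ε/(1-ε) ≤ 2ε`
  have hF : ∀ c, ∫ t in (1 + ε)..(1 + ε / (1 - ε)), ‖lineDens c t‖ ≤ 2 * ε := by
    intro c
    have hbd : ∀ t ∈ Set.uIoc (1 + ε) (1 + ε / (1 - ε)), ‖(‖lineDens c t‖ : ℝ)‖ ≤ ε⁻¹ := by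
      intro t ht
      rw [uIoc_of_le hab] at ht
      rw [Real.norm_eq_abs, abs_norm, lineDens, mul_one]
      have ht1 : ε < t - 1 := by linarith [ht.1]
      cases c
      · rw [fKZ_false, norm_inv, Complex.norm_real, Real.norm_eq_abs, abs_of_pos (by linarith [ht.1])]
        exact inv_anti₀ hε (by linarith)
      · rw [fKZ_true, show (t : ℂ) - 1 = ((t - 1 : ℝ) : ℂ) by push_cast; ring, norm_inv,
          Complex.norm_real, Real.norm_eq_abs, abs_of_pos (by linarith)]
        exact inv_anti₀ hε ht1.le
    have h := intervalIntegral.norm_integral_le_of_norm_le_const hbd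
    rw [show 1 + ε / (1 - ε) - (1 + ε) = ε * (ε / (1 - ε)) by field_simp; ring,
      abs_of_pos (by positivity), Real.norm_eq_abs] at h
    have h2 : ε / (1 - ε) ≤ 2 * ε := by rw [div_le_iff₀ h1ε]; nlinarith
    calc ∫ t in (1 + ε)..(1 + ε / (1 - ε)), ‖lineDens c t‖
        ≤ |∫ t in (1 + ε)..(1 + ε / (1 - ε)), ‖lineDens c t‖| := le_abs_self _
      _ ≤ ε⁻¹ * (ε * (ε / (1 - ε))) := h
      _ = ε / (1 - ε) := by field_simp
      _ ≤ 2 * ε := h2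
  calc (u.map fun c => ∫ t in (1 + ε)..(1 + ε / (1 - ε)), ‖lineDens c t‖).prod
      ≤ (u.map fun _ => 2 * ε).prod :=
        list_prod_map_le_prod_map u (fun c _ => intervalIntegral.integral_nonneg hab
          fun t _ => norm_nonneg _) fun c _ => hF c
    _ = (2 * ε) ^ u.length := by rw [List.map_const', List.prod_replicate]
    _ ≤ 2 * ε := pow_le_of_le_one (by positivity) (by linarith)
        (Nat.one_le_iff_ne_zero.mp (List.length_pos_iff.mpr hu))

end CapEstimate

/-- **The limit of the cap**: `E₀ = e^{-iπ B}`. [cite: Drinfeld1991, §2] -/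
def E₀ : NCSeries Bool ℂ := expLetter true (-(Real.pi : ℂ) * I)

/-- `cap - E₀ = (mini - 1) circT + (circT - E₀)`. [folklore] -/
theorem cap_sub_E₀ (ε : ℝ) : cap ε - E₀ = (mini ε - 1) * circT ε + (circT ε - E₀) := by
  rw [cap, sub_mul, one_mul]; abel

/-- **`cap_ε = e^{-iπB} + O(ε)` coefficientwise.** [cite: Drinfeld1991, §2] -/
theorem small_cap_sub_E₀ : Small (fun ε => cap ε - E₀) := by
  intro w
  refine ⟨2 * 4 ^ w.length * (w.length + 2), 0, by positivity, fun ε hε => ?_⟩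
  obtain ⟨hε, hε2⟩ := hε
  have hπ4 : ∀ k ≤ w.length, Real.pi ^ k ≤ (4 : ℝ) ^ w.length := fun k hk =>
    (pow_le_pow_left₀ Real.pi_pos.le Real.pi_le_four k).trans
      (pow_le_pow_right₀ (by norm_num) hk)
  show ‖(cap ε - E₀) w‖ ≤ _
  rw [pow_zero, mul_one, cap_sub_E₀, NCSeries.add_apply]
  refine (norm_add_le _ _).trans ?_
  -- the first term
  have h1 : ‖((mini ε - 1) * circT ε) w‖ ≤ (w.length + 1) * (2 * ε * 4 ^ w.length) := by
    rw [NCSeries.mul_apply]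
    refine (norm_sum_le _ _).trans ?_
    have hterm : ∀ p ∈ NCSeries.splits w, ‖(mini ε - 1) p.1 * circT ε p.2‖ ≤ 2 * ε * 4 ^ w.length := by
      intro p hp
      rw [NCSeries.mem_splits] at hp
      have hlen2 : p.2.length ≤ w.length := by rw [← hp]; simp
      rw [norm_mul]
      rcases eq_or_ne p.1 [] with h0 | h0
      · have : (mini ε - 1) p.1 = 0 := by
          rw [h0, NCSeries.sub_apply, mini, ctransport_apply, citerInt_nil, NCSeries.one_apply_nil, sub_self]
        rw [this, norm_zero, zero_mul]; positivity
      · have hm : ‖(mini ε - 1) p.1‖ ≤ 2 * ε := by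
          obtain ⟨d, u, hdu⟩ := List.exists_cons_of_ne_nil h0
          rw [NCSeries.sub_apply, hdu, NCSeries.one_apply_cons, sub_zero, ← hdu]
          exact norm_mini_le hε hε2 h0
        calc ‖(mini ε - 1) p.1‖ * ‖circT ε p.2‖ ≤ (2 * ε) * Real.pi ^ p.2.length :=
              mul_le_mul hm (norm_circT_le hε hε2 p.2) (norm_nonneg _) (by positivity)
          _ ≤ 2 * ε * 4 ^ w.length := mul_le_mul_of_nonneg_left (hπ4 _ hlen2) (by positivity)
    calc ∑ p ∈ NCSeries.splits w, ‖(mini ε - 1) p.1 * circT ε p.2‖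
        ≤ ∑ p ∈ NCSeries.splits w, 2 * ε * 4 ^ w.length := Finset.sum_le_sum hterm
      _ = (w.length + 1) * (2 * ε * 4 ^ w.length) := by
          rw [Finset.sum_const, card_splits, nsmul_eq_mul]; push_cast; ring
  -- the second term
  have h2 : ‖(circT ε - E₀) w‖ ≤ 2 * ε * 4 ^ w.length := by
    rw [NCSeries.sub_apply]
    by_cases hw : w = List.replicate w.length true
    · have key := circT_replicate_true hε hε2 w.length
      rw [← hw] at key
      rw [key, E₀, sub_self, norm_zero]; positivity
    · have hE : E₀ w = 0 := expLetter_apply_of_ne true _ hw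
      have hmem : false ∈ w := by
        by_contra hf
        apply hw
        refine List.eq_replicate_iff.mpr ⟨rfl, fun b hb => ?_⟩
        cases b
        · exact absurd hb hf
        · rfl
      rw [hE, sub_zero]
      exact (norm_circT_le_of_mem hε hε2 hmem).trans
        (mul_le_mul_of_nonneg_left (hπ4 _ le_rfl) (by positivity))
  calc ‖((mini ε - 1) * circT ε) w‖ + ‖(circT ε - E₀) w‖
      ≤ (w.length + 1) * (2 * ε * 4 ^ w.length) + 2 * ε * 4 ^ w.length := add_le_add h1 h2
    _ = 2 * 4 ^ w.length * (w.length + 2) * ε := by ring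

/-! ### The limits of `K_ε` and `Φ_ε` -/

/-- `K_ε - E₀ = e^{LB} (cap_ε - E₀) e^{-LB}` (exponentials of `B` commute with `E₀`). [folklore] -/
theorem Kc_sub_E₀ (ε : ℝ) :
    Kc ε - E₀ = expLetter true (Lr ε : ℂ) * (cap ε - E₀) * expLetter true (-(Lr ε : ℂ)) := by
  rw [Kc, mul_sub, sub_mul, E₀, expLetter_comm true (Lr ε : ℂ) (-(Real.pi : ℂ) * I),
    mul_assoc (expLetter true (-(Real.pi : ℂ) * I)), expLetter_mul_expLetter_neg, mul_one]

/-- **`K_ε = E₀ + O(ε (1+|log ε|)^{2|w|})`.** [cite: Drinfeld1991, §2] -/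
theorem small_Kc_sub_E₀ : Small (fun ε => Kc ε - E₀) := by
  have h : (fun ε => Kc ε - E₀) = fun ε =>
      expLetter true (((1 : ℝ) * Lr ε : ℝ) : ℂ) * (cap ε - E₀) * expLetter true (((-1 : ℝ) * Lr ε : ℝ) : ℂ) := by
    funext ε; rw [Kc_sub_E₀]; push_cast; ring_nf
  rw [h]
  exact ((logBdd_expLetter true 1 (by norm_num)).mul_small small_cap_sub_E₀).mul_logBdd
    (logBdd_expLetter true (-1) (by norm_num))

/-- **`K_ε → e^{-iπB}` coefficientwise as `ε → 0⁺`.** [cite: Drinfeld1991, §2] -/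
theorem tendsto_Kc (w : List Bool) : Tendsto (fun ε => Kc ε w) (𝓝[>] 0) (𝓝 (E₀ w)) := by
  have h := small_Kc_sub_E₀.tendsto w
  have h' : Tendsto (fun ε => (Kc ε - E₀) w + E₀ w) (𝓝[>] 0) (𝓝 (0 + E₀ w)) := h.add tendsto_const_nhds
  simpa using h'

/-- The KZ alphabet embedding `bsub A B` on `Bool` is the identity. [folklore] -/
theorem bsub_false_true : (NCSeries.bsub false true : Bool → Bool) = id := by
  funext c; cases c <;> rfl

/-- **The regularised transport tends to `Φ_KZ`**: `Φ_ε - Φ_KZ` is small, from the rate bound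
of `DrinfeldAssociatorEdge.lean` / `DrinfeldAssociatorLimit.lean`.
[cite: Furusho2003, Prop. 3.2.3] -/
theorem small_Φc_sub : Small (fun ε => Φc ε - NCSeries.map (algebraMap ℝ ℂ) drinfeldAssociator) := by
  intro w
  refine ⟨Shuffle.regNorm false true w * ((w.length + 1) ^ 2 * 16 ^ w.length * (2 * 2 ^ w.length)), w.length,
    by positivity [Shuffle.regNorm_nonneg false true w], fun ε hε => ?_⟩
  obtain ⟨hε0, hε2⟩ := hε
  show ‖(Φc ε - NCSeries.map (algebraMap ℝ ℂ) drinfeldAssociator) w‖ ≤ _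
  rw [NCSeries.sub_apply, Φc, NCSeries.map_apply, NCSeries.map_apply, ← map_sub, Complex.coe_algebraMap,
    Complex.norm_real, Real.norm_eq_abs, Φr]
  have h := abs_pair_reg_map_sub_drinfeldAssociator_le (x := false) (y := true) (f := KZ3.F₀)
    Bool.false_ne_true (fun t _ => KZ3.F₀_false t) (fun t _ => KZ3.F₀_true t) hε0 hε2
    (by linarith : (1 : ℝ) / 2 < 1 - ε) (by linarith : 1 - ε < 1) w
  rw [bsub_false_true, List.map_id] at h
  refine h.trans ?_
  have hrate : KZ3.rate w.length ε (1 - ε) ≤ 2 * 2 ^ w.length * (1 + |Real.log ε|) ^ w.length * ε := by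
    rw [KZ3.rate, show (1 : ℝ) - (1 - ε) = ε by ring]
    have hb : (|Real.log ε| + 2) ^ w.length ≤ 2 ^ w.length * (1 + |Real.log ε|) ^ w.length := by
      rw [← mul_pow]
      exact pow_le_pow_left₀ (by positivity) (by linarith [abs_nonneg (Real.log ε)]) _
    nlinarith [hb, hε0.le]
  have hR := Shuffle.regNorm_nonneg false true w
  calc Shuffle.regNorm false true w * ((w.length + 1) ^ 2 * 16 ^ w.length * KZ3.rate w.length ε (1 - ε))
      ≤ Shuffle.regNorm false true w * ((w.length + 1) ^ 2 * 16 ^ w.length *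
          (2 * 2 ^ w.length * (1 + |Real.log ε|) ^ w.length * ε)) := by
        gcongr
    _ = Shuffle.regNorm false true w * ((w.length + 1) ^ 2 * 16 ^ w.length * (2 * 2 ^ w.length)) *
          (1 + |Real.log ε|) ^ w.length * ε := by ring

/-- **`Φ_ε → Φ_KZ` coefficientwise as `ε → 0⁺`.** [cite: Furusho2003, Prop. 3.2.3] -/
theorem tendsto_Φc (w : List Bool) :
    Tendsto (fun ε => Φc ε w) (𝓝[>] 0) (𝓝 (NCSeries.map (algebraMap ℝ ℂ) drinfeldAssociator w)) := by
  have h := small_Φc_sub.tendsto w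
  have h' : Tendsto (fun ε => (Φc ε - NCSeries.map (algebraMap ℝ ℂ) drinfeldAssociator) w +
      NCSeries.map (algebraMap ℝ ℂ) drinfeldAssociator w) (𝓝[>] 0)
      (𝓝 (0 + NCSeries.map (algebraMap ℝ ℂ) drinfeldAssociator w)) := h.add tendsto_const_nhds
  simpa using h'

/-! ### The limit identity -/

/-- A family eventually equal to `1` with a coefficientwise limit has limit `1`. [folklore] -/
theorem eq_one_of_tendsto' {ι : Type*} {l : Filter ι} [l.NeBot] {F : ι → NCSeries Bool ℂ}
    {F₀ : NCSeries Bool ℂ} (hF : ∀ u, Tendsto (fun i => F i u) l (𝓝 (F₀ u))) (h1 : ∀ᶠ i in l, F i = 1) :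
    F₀ = 1 := by
  funext u
  have h : Tendsto (fun i => F i u) l (𝓝 ((1 : NCSeries Bool ℂ) u)) :=
    tendsto_const_nhds.congr' (h1.mono fun i hi => by dsimp only; rw [hi])
  exact tendsto_nhds_unique (hF u) h

/-- **The limit identity** [Drinfeld1991, (2.12)/(5.3) for `Φ_KZ`]: in `ℂ⟨⟨X₀,X₁⟩⟩`,
`σ̂²(E₀) σ̂²(Φ) σ̂(E₀) σ̂(Φ) E₀ Φ = 1` with `Φ = Φ_KZ`, `E₀ = e^{-iπX₁}`, `σ̂ : X₀ ↦ X₁ ↦ -X₀-X₁`,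
i.e. `e^{-iπA} Φ(C,A) e^{-iπC} Φ(B,C) e^{-iπB} Φ(A,B) = 1`, `C = -A-B`.
[cite: Drinfeld1991, (5.3)] -/
theorem limit_identity :
    NCSeries.push mrho (NCSeries.push mrho E₀) *
      NCSeries.push mrho (NCSeries.push mrho (NCSeries.map (algebraMap ℝ ℂ) drinfeldAssociator)) *
      NCSeries.push mrho E₀ * NCSeries.push mrho (NCSeries.map (algebraMap ℝ ℂ) drinfeldAssociator) *
      E₀ * NCSeries.map (algebraMap ℝ ℂ) drinfeldAssociator = 1 := by
  set Φ := NCSeries.map (algebraMap ℝ ℂ) drinfeldAssociator with hΦ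
  set σ := NCSeries.push (K := ℂ) mrho with hσ
  have hK : ∀ u, Tendsto (fun ε => Kc ε u) (𝓝[>] 0) (𝓝 (E₀ u)) := tendsto_Kc
  have hP : ∀ u, Tendsto (fun ε => Φc ε u) (𝓝[>] 0) (𝓝 (Φ u)) := tendsto_Φc
  have hσK : ∀ u, Tendsto (fun ε => σ (Kc ε) u) (𝓝[>] 0) (𝓝 (σ E₀ u)) :=
    NCSeries.tendsto_push_apply mrho hK
  have hσP : ∀ u, Tendsto (fun ε => σ (Φc ε) u) (𝓝[>] 0) (𝓝 (σ Φ u)) :=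
    NCSeries.tendsto_push_apply mrho hP
  have hσσK : ∀ u, Tendsto (fun ε => σ (σ (Kc ε)) u) (𝓝[>] 0) (𝓝 (σ (σ E₀) u)) :=
    NCSeries.tendsto_push_apply mrho hσK
  have hσσP : ∀ u, Tendsto (fun ε => σ (σ (Φc ε)) u) (𝓝[>] 0) (𝓝 (σ (σ Φ) u)) :=
    NCSeries.tendsto_push_apply mrho hσP
  refine eq_one_of_tendsto' (l := 𝓝[>] (0 : ℝ))
    (F := fun ε => σ (σ (Kc ε)) * σ (σ (Φc ε)) * σ (Kc ε) * σ (Φc ε) * Kc ε * Φc ε) ?_ ?_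
  · exact NCSeries.tendsto_mul_apply (NCSeries.tendsto_mul_apply (NCSeries.tendsto_mul_apply
      (NCSeries.tendsto_mul_apply (NCSeries.tendsto_mul_apply hσσK hσσP) hσK) hσP) hK) hP
  · filter_upwards [Ioo_mem_nhdsGT (by norm_num : (0 : ℝ) < 1 / 2)] with ε hε
    exact loop_identity_K hε.1 hε.2

/-! ## 7. The 3-cycle relation with `μ = -2πi`, the hexagons, and the GT-relations -/

/-- `[exp S] = truncExp [S]` in `ℂ⟨⟨X₀,X₁⟩⟩/(deg > N)` for `S` without constant term. [folklore] -/
theorem mk_exp_eq_truncExp {S : NCSeries Bool ℂ} (hS : S [] = 0) (N : ℕ) :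
    Ideal.Quotient.mk (NCSeries.truncIdeal Bool ℂ N) (NCSeries.exp S) =
      truncExp ℂ N (Ideal.Quotient.mk (NCSeries.truncIdeal Bool ℂ N) S) := by
  rw [NCSeries.mk_eq_evalTrunc_letter N (NCSeries.exp S),
    NCSeries.evalTrunc_exp N _ (NCSeries.prod_map_mk_letter_eq_zero N) hS,
    ← NCSeries.mk_eq_evalTrunc_letter N S]
  rfl

/-- `E₀ = exp(-iπ X₁)` as an `NCSeries.exp`. [folklore] -/
theorem E₀_eq_exp : E₀ = NCSeries.exp ((-(Real.pi : ℂ) * I) • NCSeries.letter true) := by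
  rw [E₀, expLetter_eq_exp_smul]

/-- `σ̂(E₀) = exp(-iπ (-X₀ - X₁))`. [folklore] -/
theorem push_E₀ : NCSeries.push mrho E₀ =
    NCSeries.exp ((-(Real.pi : ℂ) * I) • (-NCSeries.letter false - NCSeries.letter true)) := by
  rw [E₀_eq_exp, NCSeries.push_exp mrho (by simp), NCSeries.push_smul_ser, push_mrho_letter_true]

/-- `σ̂²(E₀) = exp(-iπ X₀)`. [folklore] -/
theorem push_push_E₀ : NCSeries.push mrho (NCSeries.push mrho E₀) =
    NCSeries.exp ((-(Real.pi : ℂ) * I) • NCSeries.letter false) := by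
  rw [E₀, push_push_mrho_expLetter_true, expLetter_eq_exp_smul]

/-- **Drinfeld's 3-cycle relation for `Φ_KZ` with `μ = -2πi`** [Drinfeld1991, (5.3)] in the form
[Furusho2010, Lemma 7, (13)]:
`e^{μX/2} Φ(Z,X) e^{μZ/2} Φ(Y,Z) e^{μY/2} Φ(X,Y) = 1`, `X + Y + Z = 0`, in every truncation.
[cite: Drinfeld1991, (5.3)] -/
theorem threeCycle_drinfeldAssociator :
    NCSeries.ThreeCycle (-(2 * Real.pi * Complex.I)) (NCSeries.map (algebraMap ℝ ℂ) drinfeldAssociator) := by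
  intro N
  set Φ := NCSeries.map (algebraMap ℝ ℂ) drinfeldAssociator with hΦ
  set q := Ideal.Quotient.mk (NCSeries.truncIdeal Bool ℂ N) with hq
  set x := q NCSeries.X₀ with hx
  set y := q NCSeries.X₁ with hy
  have hm : ((1 / 2 : ℚ) • (-(2 * (Real.pi : ℂ) * Complex.I))) = -(Real.pi : ℂ) * I := by
    rw [Rat.smul_def]; push_cast; ring
  rw [hm]
  -- the substituted letters
  have hv : (fun b => ∑ c, mrho b c • q (NCSeries.letter c)) = NCSeries.bsub y (-x - y) := by
    funext b; cases b
    · rw [Fintype.sum_bool]; simp [mrho, NCSeries.bsub, hy]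
    · rw [Fintype.sum_bool]; simp only [mrho, NCSeries.bsub, cond_true, neg_one_smul, hx, hy]; abel
  have hsmul : ∀ (c : ℂ) (S : NCSeries Bool ℂ), q (c • S) = c • q S := fun c S => by
    rw [hq, ← Ideal.Quotient.mkₐ_eq_mk ℂ, map_smul]
  -- apply the quotient map to the limit identity
  have h := congrArg q limit_identity
  rw [map_one, map_mul, map_mul, map_mul, map_mul, map_mul] at h
  -- identify the six factors
  have e1 : q Φ = NCSeries.evalTrunc N (NCSeries.bsub x y) Φ := by
    rw [hx, hy, hq, ← NCSeries.mk_evalTrunc N Φ, NCSeries.mk_evalTrunc_X₀_X₁]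
  have e2 : q (NCSeries.push mrho Φ) = NCSeries.evalTrunc N (NCSeries.bsub y (-x - y)) Φ := by
    rw [hq, NCSeries.mk_push, ← hq, hv]
  -- `σ̂²`: evaluate `push mrho Φ` through the quotient, where it is `Φ(y, -x-y)` by `e2`
  have hv0 : ∀ w : List Bool, N < w.length → (w.map (NCSeries.bsub y (-x - y))).prod = 0 := by
    rw [← hv]; exact NCSeries.prod_map_pushLetters_eq_zero mrho N
  set F := NCSeries.evalQuotHom (R := ℂ) N (NCSeries.bsub y (-x - y)) hv0 with hF
  have hFx : F x = y := by
    rw [hx, hq, hF, NCSeries.evalQuotHom_mk]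
    exact NCSeries.evalTrunc_letter N _ hv0 false
  have hFy : F y = -x - y := by
    rw [hy, hq, hF, NCSeries.evalQuotHom_mk]
    exact NCSeries.evalTrunc_letter N _ hv0 true
  have e3 : q (NCSeries.push mrho (NCSeries.push mrho Φ)) = NCSeries.evalTrunc N (NCSeries.bsub (-x - y) x) Φ := by
    rw [hq, NCSeries.mk_push, ← hq, hv, ← NCSeries.evalQuotHom_mk (R := ℂ) N _ hv0 (NCSeries.push mrho Φ), ← hF, ← hq,
      e2, NCSeries.algHom_evalTrunc, NCSeries.comp_bsub, map_sub, map_neg, hFx, hFy,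
      show -y - (-x - y) = x by abel]
  have e4 : q E₀ = truncExp ℂ N ((-(Real.pi : ℂ) * I) • y) := by
    rw [E₀_eq_exp, hq, mk_exp_eq_truncExp (by simp), ← hq, hsmul, ← hy]
  have e5 : q (NCSeries.push mrho E₀) = truncExp ℂ N ((-(Real.pi : ℂ) * I) • (-x - y)) := by
    rw [push_E₀, hq, mk_exp_eq_truncExp (by simp), ← hq, hsmul, map_sub, map_neg, ← hx, ← hy]
  have e6 : q (NCSeries.push mrho (NCSeries.push mrho E₀)) = truncExp ℂ N ((-(Real.pi : ℂ) * I) • x) := by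
    rw [push_push_E₀, hq, mk_exp_eq_truncExp (by simp), ← hq, hsmul, ← hx]
  rw [e1, e2, e3, e4, e5, e6] at h
  exact h

/-! ## 8. The 2-cycle relation `Φ_KZ(B,A) Φ_KZ(A,B) = 1` by the symmetry `z ↦ 1 - z` [Drinfeld1991, §2] -/

/-- The letter matrix of the exchange `A ↔ B` induced by `τ(z) = 1 - z`. [cite: Drinfeld1991, §2] -/
def mswap : Bool → Bool → ℂ
  | false, true => 1
  | true, false => 1
  | _, _ => 0

/-- **The pull-back of the KZ form under `τ(z) = 1-z`** exchanges the letters: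
`f_c(1-z) · (-1) = f_{¬c}(z) = Σ_b mswap(b,c) f_b(z)`. [cite: Drinfeld1991, §2] -/
theorem fKZ_one_sub (c : Bool) (z : ℂ) : fKZ c (1 - z) * (-1) = ∑ b, mswap b c * fKZ b z := by
  rw [Fintype.sum_bool]
  cases c
  · simp only [fKZ_false, fKZ_true, mswap, one_mul, zero_mul, add_zero]
    rw [mul_neg_one, ← inv_neg, neg_sub]
  · simp only [fKZ_false, fKZ_true, mswap, one_mul, zero_mul, zero_add]
    rw [mul_neg_one, ← inv_neg, neg_sub, sub_sub_cancel]

/-- **`push mswap` is the exchange of letters `swapXY`.** [folklore] -/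
theorem push_mswap (X : NCSeries Bool ℂ) : NCSeries.push mswap X = NCSeries.swapXY X := by
  apply NCSeries.eq_of_forall_mk_eq
  intro N
  rw [NCSeries.mk_push, ← NCSeries.mk_evalTrunc_X₁_X₀, NCSeries.mk_evalTrunc]
  congr 1
  funext b
  cases b
  · rw [Fintype.sum_bool]; simp [mswap, NCSeries.bsub]
  · rw [Fintype.sum_bool]; simp [mswap, NCSeries.bsub]

namespace KZPath

variable {s : Set ℝ}

/-- **The reflected path `τ ∘ γ = 1 - γ`** (a `C¹` path in `ℂ ∖ {0,1}` on `s`). [cite: Drinfeld1991, §2] -/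
def tauPath (d : KZPath s) : KZPath s where
  γ := fun t => 1 - d.γ t
  γ' := fun t => -1 * d.γ' t
  hasDeriv := fun t ht => by
    have h := (d.hasDeriv t ht).const_sub 1
    rwa [neg_one_mul]
  cont := continuousOn_const.mul d.cont
  ne_zero := fun t ht h => d.ne_one t ht (by linear_combination -h)
  ne_one := fun t ht h => d.ne_zero t ht (by linear_combination -h)

/-- **Functoriality of the transport under `τ(z) = 1-z`**: the transport along `1 - γ` is
`swapXY` of the transport along `γ`. [cite: Drinfeld1991, §2] -/
theorem T_tauPath (d : KZPath s) (hs : IsOpen s) (hso : s.OrdConnected) {a b : ℝ} (ha : a ∈ s)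
    (hb : b ∈ s) : d.tauPath.T a b = NCSeries.swapXY (d.T a b) := by
  unfold T
  rw [← push_mswap, ← ctransport_linComb hs hso d.continuousOn_dens ha mswap hb]
  funext w
  rw [ctransport_apply, ctransport_apply]
  refine citerInt_congr (fun c t _ => ?_) w right_mem_uIcc
  rw [dens_apply, show d.tauPath.γ t = 1 - d.γ t from rfl,
    show d.tauPath.γ' t = -1 * d.γ' t from rfl, ← mul_assoc, fKZ_one_sub, Finset.sum_mul]
  refine Finset.sum_congr rfl fun b _ => ?_
  rw [dens_apply, mul_assoc]

end KZPath

/-- **The 2-cycle relation for the segment, exactly**: `swapXY(seg_ε) · seg_ε = 1` and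
`seg_ε · swapXY(seg_ε) = 1` — `swapXY(seg)` is the transport along the reversed segment
`1 - t : 1-ε → ε`. [cite: Drinfeld1991, §2] -/
theorem swapXY_seg_mul_seg {ε : ℝ} (hε : 0 < ε) (hε2 : ε < 1 / 2) :
    NCSeries.swapXY (seg ε) * seg ε = 1 ∧ seg ε * NCSeries.swapXY (seg ε) = 1 := by
  have hε1 : ε < 1 := by linarith
  have h1ε : (0 : ℝ) < 1 - ε := by linarith
  have hI0 : (0 : ℝ) ∉ Ioo (0 : ℝ) 1 := by simp
  have hI1 : (1 : ℝ) ∉ Ioo (0 : ℝ) 1 := by simp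
  set Lm := linePath (Ioo (0 : ℝ) 1) hI0 hI1 with hLm
  have hIcc : Icc ε (1 - ε) ⊆ Ioo (0 : ℝ) 1 := fun t ht => ⟨by linarith [ht.1], by linarith [ht.2]⟩
  have hab : ε ≤ 1 - ε := by linarith
  have mε : ((ε : ℝ) : ℂ) ∈ D0 := ofReal_mem_D0 ⟨hε, hε1⟩
  have m1ε : ((1 - ε : ℝ) : ℂ) ∈ D0 := ofReal_mem_D0 ⟨h1ε, by linarith⟩
  have f1 : kzFund D0 fKZ ε ((1 - ε : ℝ) : ℂ) = seg ε :=
    Lm.kzFund_eq_T isOpen_Ioo hasPrims_D.1 isOpen_D.1 zero_one_not_mem_D0.1 zero_one_not_mem_D0.2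
      hab hIcc fun t ht => ofReal_mem_D0 (hIcc ht)
  -- the reflected segment `1 - t`, `t ∈ [ε, 1-ε]`, runs from `1-ε` to `ε` inside `D₀`
  have e1 : Lm.tauPath.γ ε = ((1 - ε : ℝ) : ℂ) := by
    show (1 : ℂ) - (ε : ℂ) = ((1 - ε : ℝ) : ℂ); push_cast; ring
  have e2 : Lm.tauPath.γ (1 - ε) = ((ε : ℝ) : ℂ) := by
    show (1 : ℂ) - ((1 - ε : ℝ) : ℂ) = (ε : ℂ); push_cast; ring
  have f2 : kzFund D0 fKZ ((1 - ε : ℝ) : ℂ) ε = NCSeries.swapXY (seg ε) := by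
    rw [seg, ← linePath_T_eq (Ioo 0 1) hI0 hI1, ← hLm,
      ← Lm.T_tauPath isOpen_Ioo ordConnected_Ioo ⟨hε, hε1⟩ ⟨h1ε, by linarith⟩, ← e1, ← e2]
    refine Lm.tauPath.kzFund_eq_T isOpen_Ioo hasPrims_D.1 isOpen_D.1 zero_one_not_mem_D0.1
      zero_one_not_mem_D0.2 hab hIcc fun t ht => ?_
    have h := ofReal_mem_D0 (t := 1 - t) ⟨by linarith [(hIcc ht).2], by linarith [(hIcc ht).1]⟩
    have : Lm.tauPath.γ t = ((1 - t : ℝ) : ℂ) := by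
      show (1 : ℂ) - (t : ℂ) = ((1 - t : ℝ) : ℂ); push_cast; ring
    rwa [this]
  have chen0 := kzFund_mul_kzFund hasPrims_D.1 (fun c => (differentiableOn_fKZ_D c).1) isOpen_D.1 convex_D.1
  constructor
  · rw [← f2, ← f1, chen0 _ m1ε _ mε, kzFund_self]
  · rw [← f2, ← f1, chen0 _ mε _ m1ε, kzFund_self]

/-- `swapXY` passes to coefficientwise limits. [folklore] -/
theorem tendsto_swapXY_apply {ι : Type*} {l : Filter ι} {F : ι → NCSeries Bool ℂ} {F₀ : NCSeries Bool ℂ}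
    (hF : ∀ u, Tendsto (fun i => F i u) l (𝓝 (F₀ u))) (w : List Bool) :
    Tendsto (fun i => NCSeries.swapXY (F i) w) l (𝓝 (NCSeries.swapXY F₀ w)) := by
  simp only [NCSeries.swapXY_apply]; exact hF _

/-- **The 2-cycle relation for the regularised transport, exactly**:
`swapXY(Φ_ε) Φ_ε = 1 = Φ_ε swapXY(Φ_ε)` (the divergent factors `e^{∓L·}` cancel).
[cite: Drinfeld1991, §2] -/
theorem swapXY_Φc_mul_Φc {ε : ℝ} (hε : 0 < ε) (hε2 : ε < 1 / 2) :
    NCSeries.swapXY (Φc ε) * Φc ε = 1 ∧ Φc ε * NCSeries.swapXY (Φc ε) = 1 := by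
  have hε1 : ε < 1 := by linarith
  obtain ⟨h1, h2⟩ := swapXY_seg_mul_seg hε hε2
  set L : ℂ := (Lr ε : ℂ) with hL
  have hsw : ∀ (c : Bool) (ℓ : ℂ), NCSeries.swapXY (expLetter c ℓ) = expLetter (!c) ℓ := by
    intro c ℓ
    rw [← push_mswap, expLetter_eq_exp_smul, expLetter_eq_exp_smul, NCSeries.push_exp mswap (by simp),
      NCSeries.push_smul_ser, NCSeries.push_letter, Fintype.sum_bool]
    cases c <;> simp [mswap]
  have hswmul : ∀ X Y : NCSeries Bool ℂ, NCSeries.swapXY (X * Y) = NCSeries.swapXY X * NCSeries.swapXY Y := by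
    intro X Y; rw [← push_mswap, ← push_mswap, ← push_mswap, NCSeries.push_mul]
  rw [seg_factorisation hε hε1, ← hL] at h1 h2
  simp only [hswmul, hsw, Bool.not_true, Bool.not_false] at h1 h2
  -- h1 : E_A(-L) Φ̄ E_B(L) * (E_B(-L) Φ E_A(L)) = 1 ;  h2 : E_B(-L) Φ E_A(L) * (E_A(-L) Φ̄ E_B(L)) = 1
  have hA : expLetter false L * expLetter false (-L) = 1 := expLetter_mul_expLetter_neg false L
  have hA' : expLetter false (-L) * expLetter false L = 1 := expLetter_neg_mul_expLetter false L
  have hB : expLetter true L * expLetter true (-L) = 1 := expLetter_mul_expLetter_neg true L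
  have hB' : expLetter true (-L) * expLetter true L = 1 := expLetter_neg_mul_expLetter true L
  constructor
  · -- conjugate h1 by e^{LA}
    have h1' : expLetter false (-L) * (NCSeries.swapXY (Φc ε) * Φc ε) * expLetter false L = 1 := by
      calc _ = expLetter false (-L) * NCSeries.swapXY (Φc ε) * (expLetter true L * expLetter true (-L)) *
            Φc ε * expLetter false L := by rw [hB, mul_one]; simp only [mul_assoc]
        _ = 1 := by simpa only [mul_assoc] using h1
    calc NCSeries.swapXY (Φc ε) * Φc ε
        = expLetter false L * (expLetter false (-L) * (NCSeries.swapXY (Φc ε) * Φc ε) * expLetter false L) *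
            expLetter false (-L) := by
          rw [← mul_assoc, ← mul_assoc, hA, one_mul, mul_assoc, hA, mul_one]
      _ = 1 := by rw [h1', mul_one, hA]
  · have h2' : expLetter true (-L) * (Φc ε * NCSeries.swapXY (Φc ε)) * expLetter true L = 1 := by
      calc _ = expLetter true (-L) * Φc ε * (expLetter false L * expLetter false (-L)) *
            NCSeries.swapXY (Φc ε) * expLetter true L := by rw [hA, mul_one]; simp only [mul_assoc]
        _ = 1 := by simpa only [mul_assoc] using h2
    calc Φc ε * NCSeries.swapXY (Φc ε)
        = expLetter true L * (expLetter true (-L) * (Φc ε * NCSeries.swapXY (Φc ε)) * expLetter true L) *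
            expLetter true (-L) := by
          rw [← mul_assoc, ← mul_assoc, hB, one_mul, mul_assoc, hB, mul_one]
      _ = 1 := by rw [h2', mul_one, hB]

/-- **The 2-cycle relation for `Φ_KZ`** [Drinfeld1991, §2, the symmetry `z ↦ 1-z`]:
`Φ_KZ(B,A) Φ_KZ(A,B) = 1 = Φ_KZ(A,B) Φ_KZ(B,A)` in `ℂ⟨⟨A,B⟩⟩`. [cite: Drinfeld1991, §2] -/
theorem two_cycle_drinfeldAssociator :
    NCSeries.map (algebraMap ℝ ℂ) drinfeldAssociator * NCSeries.swapXY (NCSeries.map (algebraMap ℝ ℂ) drinfeldAssociator) = 1 ∧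
      NCSeries.swapXY (NCSeries.map (algebraMap ℝ ℂ) drinfeldAssociator) * NCSeries.map (algebraMap ℝ ℂ) drinfeldAssociator = 1 := by
  set Φ := NCSeries.map (algebraMap ℝ ℂ) drinfeldAssociator with hΦ
  have hP : ∀ u, Tendsto (fun ε => Φc ε u) (𝓝[>] 0) (𝓝 (Φ u)) := tendsto_Φc
  have hS : ∀ u, Tendsto (fun ε => NCSeries.swapXY (Φc ε) u) (𝓝[>] 0) (𝓝 (NCSeries.swapXY Φ u)) :=
    tendsto_swapXY_apply hP
  have hev : ∀ᶠ ε in 𝓝[>] (0 : ℝ), ε ∈ Ioo (0 : ℝ) (1 / 2) := Ioo_mem_nhdsGT (by norm_num)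
  constructor
  · exact eq_one_of_tendsto' (l := 𝓝[>] (0 : ℝ)) (F := fun ε => Φc ε * NCSeries.swapXY (Φc ε))
      (NCSeries.tendsto_mul_apply hP hS) (hev.mono fun ε hε => (swapXY_Φc_mul_Φc hε.1 hε.2).2)
  · exact eq_one_of_tendsto' (l := 𝓝[>] (0 : ℝ)) (F := fun ε => NCSeries.swapXY (Φc ε) * Φc ε)
      (NCSeries.tendsto_mul_apply hS hP) (hev.mono fun ε hε => (swapXY_Φc_mul_Φc hε.1 hε.2).1)

end KZHex

/-! ### The theorems about `Φ_KZ` -/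

open NCSeries in
/-- **Drinfeld's 3-cycle (hexagon) relation for `Φ_KZ`, `μ = -2πi`** [Drinfeld1991, (2.12) =
(5.3)]: `e^{μA/2} Φ_KZ(C,A) e^{μC/2} Φ_KZ(B,C) e^{μB/2} Φ_KZ(A,B) = 1` with `A + B + C = 0`, proved
by the monodromy of the KZ equation ("symmetry of the KZ system", [Furusho2011, §1]).
[cite: Drinfeld1991, (5.3)] -/
theorem drinfeldAssociator_threeCycle :
    ThreeCycle (-(2 * Real.pi * Complex.I)) (NCSeries.map (algebraMap ℝ ℂ) drinfeldAssociator) :=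
  KZHex.threeCycle_drinfeldAssociator

open NCSeries in
/-- **The 2-cycle relation for `Φ_KZ`** [Drinfeld1991, §2]: `Φ_KZ(A,B) Φ_KZ(B,A) = 1 = Φ_KZ(B,A) Φ_KZ(A,B)`,
by the symmetry `z ↦ 1 - z` of the KZ equation. [cite: Drinfeld1991, §2] -/
theorem drinfeldAssociator_two_cycle :
    NCSeries.map (algebraMap ℝ ℂ) drinfeldAssociator * swapXY (NCSeries.map (algebraMap ℝ ℂ) drinfeldAssociator) = 1 ∧
      swapXY (NCSeries.map (algebraMap ℝ ℂ) drinfeldAssociator) * NCSeries.map (algebraMap ℝ ℂ) drinfeldAssociator = 1 :=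
  KZHex.two_cycle_drinfeldAssociator

open NCSeries in
/-- **Drinfeld's theorem: the two hexagon equations for `(2πi, Φ_KZ)`** [Drinfeld1991, (2.12)],
unconditionally: from the 2-cycle and 3-cycle relations (monodromy) by [Furusho2010, Lemma 7]
(`NCSeries.drinfeldHexagons_of_threeCycle`), group-likeness (`drinfeldAssociator_isGroupLike_holds`)
and complex conjugation (`μ = -2πi ↦ 2πi`). [cite: Drinfeld1991, (2.12)] -/
theorem drinfeldAssociator_hexagons :
    DrinfeldHexagon (2 * Real.pi * Complex.I : ℂ) (NCSeries.map (algebraMap ℝ ℂ) drinfeldAssociator) ∧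
      DrinfeldHexagonB (2 * Real.pi * Complex.I : ℂ) (NCSeries.map (algebraMap ℝ ℂ) drinfeldAssociator) := by
  have hg : IsGroupLike (NCSeries.map (algebraMap ℝ ℂ) drinfeldAssociator) :=
    drinfeldAssociator_isGroupLike_holds.map _
  have h0 : NCSeries.map (algebraMap ℝ ℂ) drinfeldAssociator [false] = 0 := by
    rw [NCSeries.map_apply, drinfeldAssociator_X₀, map_zero]
  have h1 : NCSeries.map (algebraMap ℝ ℂ) drinfeldAssociator [true] = 0 := by
    rw [NCSeries.map_apply, drinfeldAssociator_X₁, map_zero]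
  obtain ⟨hH, hHB⟩ := drinfeldHexagons_of_threeCycle hg h0 h1 drinfeldAssociator_two_cycle
    drinfeldAssociator_threeCycle
  refine drinfeldHexagons_two_pi_I_of_sq_eq ?_ hH hHB
  rw [neg_sq, two_pi_I_sq_eq]

open NCSeries in
/-- **Drinfeld's theorem "`(2πi, Φ_KZ)` satisfies the GT-relations", reduced to its pentagon
part**: group-likeness is `drinfeldAssociator_isGroupLike_holds`, the hexagons are
`drinfeldAssociator_hexagons` (monodromy, this file), and the pentagon is the named fact
`drinfeldAssociator_pentagon` [Drinfeld1991, (2.13)]. [cite: Furusho2011, §1] -/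
theorem drinfeldAssociator_isAssociatorPair_of_pentagon' (hp : drinfeldAssociator_pentagon) :
    drinfeldAssociator_isAssociatorPair :=
  ⟨drinfeldAssociator_isGroupLike_holds.map _, hp.map _, drinfeldAssociator_hexagons⟩

end Literature.NumberTheory.Transcendental
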